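import Summits.RiemannHypothesis.RiemannHypothesis.Theses.EtaTailTrialBound
import Summits.RiemannHypothesis.RiemannHypothesis.Theorems.EtaLeadingQuarterQuarterTrialVectors

/-!
# Route EtaTailTrialBound — the support item `TrialVectorAssembly` (stmt-RiemannHypothesis-21600)

`TrialVectorAssembly : EtaTailSecondMoment → LockingLayer → RH → ∀ ε > 0, ∀ᶠ M,
  ∃ v ≠ 0, M · screwRayleigh M v ≤ 1/4 + (a′ + ε)/log M` (`a′ = screwFloorFirstOrderConst`),
with `LockingLayer` the sharpened item stmt-RiemannHypothesis-23083
((iii) reads `M · log M · Z_M(e) → 0`).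

Proof (rh-idea-7 desk): trial vector `x_m := a_M(m) + e_M(m)` on `[2, M]`, where
`a_M(m) = (1/2 if m = M else 1) · (−1)^m m^{−1/2}` is the Euler-ended eta vector and `e` the layer
of `LockingLayer`; `v i := x (i+2)`.  Gram identity over the zeros in ordinate form (tree
`EtaLeadingQuarter.Trial.hasSum_gram`, from Suzuki2023 (1.9)); split
`‖T + E‖² ≤ (1+δ)‖T‖² + (1+1/δ)‖E‖²` (tree `norm_add_sq_le_of_pos`) with the `M`-DEPENDENT
`δ := ε/(8 log M)`: the `(1+δ)` loss on `log M/4` is `ε/32`, while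
`(1/δ)·M·Z_M(e) = (8/ε)·(M log M · Z_M(e)) → 0` — exactly where the sharpened (iii) is used;
denominator `‖v‖² ≥ (1−δ′)Σ a_M² − (1/δ′)Σ e_M² ≥ log M + γ − 1 − ε/2` with `δ′ = ε/(8 log M)`,
`Σ_{m=2}^{M} a_M(m)² = H_M − 1 − 3/(4M)` and `H_M − log M → γ` (Mathlib
`Real.tendsto_harmonic_sub_log`); finally
`log M/4 + e₀′ + ε/2 ≤ (1/4 + (a′+ε)/log M)(log M + γ − 1 − ε/2)` because `e₀′ = a′ − (1−γ)/4`.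

This closes the support item r9 of route EtaTailTrialBound (rung route onto the RH-free leaf
`ScrewFloorTrialBound`, rung S-P(P1)); it is CONDITIONAL on its three hypotheses by signature and
proves nothing about RH.  Nothing here bears on the truth of RH.
-/

noncomputable section

set_option linter.dupNamespace false  -- the mandated namespace repeats `RiemannHypothesis`

namespace Summit.RiemannHypothesis.RiemannHypothesis.Theorems.EtaTailTrialBound.Trial

open Filter Topology Finset Matrix Literature.NumberTheory.LFunctions
open Summit.RiemannHypothesis.RiemannHypothesis.Theorems.IntegerScrew
open Summit.RiemannHypothesis.RiemannHypothesis.Theorems.EtaLeadingQuarter.Trial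
open Summit.RiemannHypothesis.RiemannHypothesis.Theses.EtaTailTrialBound
open scoped BigOperators

/-! ## The Euler-ended eta vector `a_M(m) = (1/2 if m = M else 1) · (−1)^m m^{−1/2}` -/

/-- `a_M(m)² = (1/4 if m = M else 1) / m`. [folklore] -/
theorem halfEta_sq (M m : ℕ) :
    ((if m = M then (1 / 2 : ℝ) else 1) * (-1 : ℝ) ^ m * (m : ℝ) ^ (-(1 / 2 : ℝ))) ^ 2 =
      (if m = M then (1 / 4 : ℝ) else 1) * (m : ℝ)⁻¹ := by
  rw [show (if m = M then (1 / 2 : ℝ) else 1) * (-1 : ℝ) ^ m * (m : ℝ) ^ (-(1 / 2 : ℝ)) =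
      (if m = M then (1 / 2 : ℝ) else 1) * ((-1 : ℝ) ^ m * (m : ℝ) ^ (-(1 / 2 : ℝ))) by ring,
    mul_pow, eta_sq]
  split_ifs <;> norm_num

/-- `Σ_{m=2}^{M} a_M(m)² = H_M − 1 − 3/(4M)` for `M ≥ 2` (`H_M = Σ_{m=1}^{M} 1/m`). [folklore] -/
theorem sum_halfEta_sq (M : ℕ) (hM : 2 ≤ M) :
    ∑ m ∈ Icc 2 M, ((if m = M then (1 / 2 : ℝ) else 1) * (-1 : ℝ) ^ m * (m : ℝ) ^ (-(1 / 2 : ℝ))) ^ 2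
      = ((harmonic M : ℚ) : ℝ) - 1 - 3 / 4 * (M : ℝ)⁻¹ := by
  simp only [halfEta_sq]
  have hharm : ((harmonic M : ℚ) : ℝ) = ∑ m ∈ Icc 1 M, (m : ℝ)⁻¹ := by
    rw [harmonic_eq_sum_Icc]; push_cast; rfl
  have hsplit1 : Icc 1 M = insert 1 (Icc 2 M) := by
    ext m
    simp only [Finset.mem_Icc, Finset.mem_insert]
    omega
  have h1 : (1 : ℕ) ∉ Icc 2 M := by simp
  obtain ⟨k, rfl⟩ : ∃ k, M = k + 1 := ⟨M - 1, by omega⟩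
  have htop : ∑ m ∈ Icc 2 (k + 1), (if m = k + 1 then (1 / 4 : ℝ) else 1) * ((m : ℕ) : ℝ)⁻¹ =
      ∑ m ∈ Icc 2 k, (if m = k + 1 then (1 / 4 : ℝ) else 1) * ((m : ℕ) : ℝ)⁻¹ +
        (if k + 1 = k + 1 then (1 / 4 : ℝ) else 1) * ((k + 1 : ℕ) : ℝ)⁻¹ :=
    Finset.sum_Icc_succ_top (by omega) _
  have hlow : ∑ m ∈ Icc 2 k, (if m = k + 1 then (1 / 4 : ℝ) else 1) * ((m : ℕ) : ℝ)⁻¹ =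
      ∑ m ∈ Icc 2 k, ((m : ℕ) : ℝ)⁻¹ :=
    Finset.sum_congr rfl fun m hm => by
      rw [if_neg (by have := (Finset.mem_Icc.mp hm).2; omega), one_mul]
  have htop' : ∑ m ∈ Icc 2 (k + 1), ((m : ℕ) : ℝ)⁻¹ =
      ∑ m ∈ Icc 2 k, ((m : ℕ) : ℝ)⁻¹ + ((k + 1 : ℕ) : ℝ)⁻¹ :=
    Finset.sum_Icc_succ_top (by omega) _
  rw [htop, hlow, if_pos rfl, hharm, hsplit1, Finset.sum_insert h1, htop']
  push_cast
  ring

/-- Splitting the trial functional: `−1 + Σ (a_m + b_m) m^{iγ} = (−1 + Σ a_m m^{iγ}) + Σ b_m m^{iγ}`.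
[folklore] -/
theorem neg_one_add_sum_split (M : ℕ) (x a b : ℕ → ℝ) (hx : ∀ m, x m = a m + b m) (γ : ℝ) :
    -1 + ∑ m ∈ Icc 2 M, ((x m : ℝ) : ℂ) * (m : ℂ) ^ (((γ : ℝ) : ℂ) * Complex.I) =
      (-1 + ∑ m ∈ Icc 2 M, ((a m : ℝ) : ℂ) * (m : ℂ) ^ (((γ : ℝ) : ℂ) * Complex.I)) +
        ∑ m ∈ Icc 2 M, ((b m : ℝ) : ℂ) * (m : ℂ) ^ (((γ : ℝ) : ℂ) * Complex.I) := by
  simp only [hx, Complex.ofReal_add, add_mul, Finset.sum_add_distrib]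
  ring

/-! ## Assembly -/

/-- **Item stmt-RiemannHypothesis-21600.** `EtaTailSecondMoment → LockingLayer → RH →
∀ ε > 0, ∀ᶠ M, ∃ v ≠ 0, M · screwRayleigh M v ≤ 1/4 + (a′ + ε)/log M` (trial vector `a_M + e_M` on
`[2, M]`, split parameter `δ = ε/(8 log M)`).  Conditional on its three hypotheses; nothing here
bears on the truth of RH. [folklore] -/
theorem trialVectorAssembly_proof : TrialVectorAssembly := by
  intro h₁ h₂ hRH ε hε
  obtain ⟨e, he_lock, he_energy, he_zero⟩ := h₂
  -- the weights `m(ρ)/γ²` are summable and nonnegative (RH-free, tree)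
  have hW : Summable fun ρ : ZetaZeros.riemannZetaNontrivialZeros =>
      (riemannZetaZeroOrder (ρ : ℂ) : ℝ) / (ρ : ℂ).im ^ 2 :=
    (ZetaScrewGrowth.summable_two_mul_order_div_im_sq.mul_left (1 / 2)).congr fun ρ => by ring
  have hWnn : ∀ ρ : ZetaZeros.riemannZetaNontrivialZeros,
      0 ≤ (riemannZetaZeroOrder (ρ : ℂ) : ℝ) / (ρ : ℂ).im ^ 2 := fun ρ =>
    div_nonneg (FordL33.order_pos ρ).le (sq_nonneg _)
  -- eventual facts
  have hlog : Tendsto (fun M : ℕ => Real.log (M : ℝ)) atTop atTop :=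
    Real.tendsto_log_atTop.comp tendsto_natCast_atTop_atTop
  have hinvlog : Tendsto (fun M : ℕ => (Real.log (M : ℝ))⁻¹) atTop (𝓝 0) :=
    hlog.inv_tendsto_atTop
  have F1 := h₁ hRH (ε / 8) (by positivity)
  have F3 : ∀ᶠ M : ℕ in atTop, Real.log M * ∑ m ∈ Icc 2 M, e M m ^ 2 < ε ^ 2 / 64 :=
    he_energy.eventually (gt_mem_nhds (by positivity))
  have F4 := he_zero.eventually (gt_mem_nhds (show (0 : ℝ) < ε ^ 2 / 128 by positivity))
  have F4' := he_zero.eventually (gt_mem_nhds (show (0 : ℝ) < ε / 16 by positivity))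
  have F5 : ∀ᶠ M : ℕ in atTop, (1 : ℝ) ≤ Real.log (M : ℝ) := hlog.eventually_ge_atTop 1
  have F6 : ∀ᶠ M : ℕ in atTop,
      |((harmonic M : ℚ) : ℝ) - Real.log M - Real.eulerMascheroniConstant| < ε / 16 := by
    have t : Tendsto (fun n : ℕ => ((harmonic n : ℚ) : ℝ) - Real.log n - Real.eulerMascheroniConstant)
        atTop (𝓝 0) := by
      have := Real.tendsto_harmonic_sub_log.sub_const Real.eulerMascheroniConstant
      rwa [sub_self] at this
    exact (Metric.tendsto_nhds.1 t (ε / 16) (by positivity)).mono fun M hM => by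
      simpa only [Real.dist_eq, sub_zero] using hM
  have F7 : ∀ᶠ M : ℕ in atTop, 3 / 4 * (M : ℝ)⁻¹ ≤ ε / 16 := by
    have : Tendsto (fun M : ℕ => 3 / 4 * (M : ℝ)⁻¹) atTop (𝓝 (3 / 4 * 0)) :=
      (tendsto_inv_atTop_zero.comp tendsto_natCast_atTop_atTop).const_mul _
    rw [mul_zero] at this
    exact (this.eventually (ge_mem_nhds (by positivity))).mono fun M hM => hM
  have F8 : ∀ᶠ M : ℕ in atTop, (|screwFloorFirstOrderConst - (1 - Real.eulerMascheroniConstant) / 4|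
      + ε / 8) * (Real.log (M : ℝ))⁻¹ ≤ 1 / 4 := by
    have : Tendsto (fun M : ℕ => (|screwFloorFirstOrderConst - (1 - Real.eulerMascheroniConstant) / 4|
        + ε / 8) * (Real.log (M : ℝ))⁻¹) atTop
        (𝓝 ((|screwFloorFirstOrderConst - (1 - Real.eulerMascheroniConstant) / 4| + ε / 8) * 0)) :=
      hinvlog.const_mul _
    rw [mul_zero] at this
    exact (this.eventually (ge_mem_nhds (by norm_num))).mono fun M hM => hM
  have F9 : ∀ᶠ M : ℕ in atTop,
      (|Real.eulerMascheroniConstant - 1| + ε / 8) * (Real.log (M : ℝ))⁻¹ ≤ 1 := by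
    have : Tendsto (fun M : ℕ => (|Real.eulerMascheroniConstant - 1| + ε / 8) * (Real.log (M : ℝ))⁻¹)
        atTop (𝓝 ((|Real.eulerMascheroniConstant - 1| + ε / 8) * 0)) := hinvlog.const_mul _
    rw [mul_zero] at this
    exact (this.eventually (ge_mem_nhds (by norm_num))).mono fun M hM => hM
  have F10 : ∀ᶠ M : ℕ in atTop, (|screwFloorFirstOrderConst + ε| *
      (|Real.eulerMascheroniConstant - 1| + ε / 2)) * (Real.log (M : ℝ))⁻¹ ≤ 3 * ε / 8 := by
    have : Tendsto (fun M : ℕ => (|screwFloorFirstOrderConst + ε| *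
        (|Real.eulerMascheroniConstant - 1| + ε / 2)) * (Real.log (M : ℝ))⁻¹) atTop
        (𝓝 ((|screwFloorFirstOrderConst + ε| * (|Real.eulerMascheroniConstant - 1| + ε / 2)) * 0)) :=
      hinvlog.const_mul _
    rw [mul_zero] at this
    exact (this.eventually (ge_mem_nhds (by positivity))).mono fun M hM => hM
  have F11 : ∀ᶠ M : ℕ in atTop, ε / 2 + 2 ≤ Real.log (M : ℝ) := hlog.eventually_ge_atTop _
  have F12 : ∀ᶠ M : ℕ in atTop, |screwFloorFirstOrderConst + ε| * (Real.log (M : ℝ))⁻¹ ≤ 1 / 8 := by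
    have : Tendsto (fun M : ℕ => |screwFloorFirstOrderConst + ε| * (Real.log (M : ℝ))⁻¹) atTop
        (𝓝 (|screwFloorFirstOrderConst + ε| * 0)) := hinvlog.const_mul _
    rw [mul_zero] at this
    exact (this.eventually (ge_mem_nhds (by norm_num))).mono fun M hM => hM
  filter_upwards [F1, he_lock, F3, F4, F4', F5, F6, F7, F8, F9, F10, F11, F12, eventually_ge_atTop 2]
    with M hF1 hF2 hF3 hF4 hF4' hF5 hF6 hF7 hF8 hF9 hF10 hF11 hF12 hM2
  -- notation: `L = log M`; the eta vector `a`, the trial vector `x`, the two zero-side functionals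
  set L : ℝ := Real.log (M : ℝ) with hL
  have hLpos : 0 < L := by linarith only [hF5]
  have hMpos : (0 : ℝ) < M := by exact_mod_cast (by omega : 0 < M)
  obtain ⟨a, ha⟩ : ∃ a : ℕ → ℝ, ∀ m : ℕ,
      a m = (if m = M then (1 / 2 : ℝ) else 1) * (-1 : ℝ) ^ m * (m : ℝ) ^ (-(1 / 2 : ℝ)) :=
    ⟨_, fun m => rfl⟩
  obtain ⟨x, hxm⟩ : ∃ x : ℕ → ℝ, ∀ m : ℕ, x m = a m + e M m := ⟨_, fun m => rfl⟩
  obtain ⟨A, hA⟩ : ∃ Z : ℝ, Z = ∑' ρ : ZetaZeros.riemannZetaNontrivialZeros,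
      (riemannZetaZeroOrder (ρ : ℂ) : ℝ) / (ρ : ℂ).im ^ 2 *
        ‖-1 + ∑ m ∈ Icc 2 M, ((a m : ℝ) : ℂ) *
          (m : ℂ) ^ ((((ρ : ℂ).im : ℝ) : ℂ) * Complex.I)‖ ^ 2 := ⟨_, rfl⟩
  obtain ⟨B, hB⟩ : ∃ Z : ℝ, Z = ∑' ρ : ZetaZeros.riemannZetaNontrivialZeros,
      (riemannZetaZeroOrder (ρ : ℂ) : ℝ) / (ρ : ℂ).im ^ 2 *
        ‖∑ m ∈ Icc 2 M, ((e M m : ℝ) : ℂ) *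
          (m : ℂ) ^ ((((ρ : ℂ).im : ℝ) : ℂ) * Complex.I)‖ ^ 2 := ⟨_, rfl⟩
  have hF1' : (M : ℝ) * A ≤
      L / 4 + (screwFloorFirstOrderConst - (1 - Real.eulerMascheroniConstant) / 4) + ε / 8 := by
    rw [hA]; simp only [ha]; exact hF1
  have hF4A : (M : ℝ) * L * B < ε ^ 2 / 128 := by rw [hB]; exact hF4
  have hF4B : (M : ℝ) * L * B < ε / 16 := by rw [hB]; exact hF4'
  set v : Fin (M - 1) → ℝ := fun i => x ((i : ℕ) + 2) with hvdef
  have hx : ∑ m ∈ Icc 2 M, x m = 1 := by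
    simp only [hxm, ha, Finset.sum_add_distrib, hF2]
    ring
  -- Gram identity and the split with δ := ε / (8 L)
  set δ : ℝ := ε / (8 * L) with hδdef
  have hδ : 0 < δ := by positivity
  have hG := hasSum_gram hRH M x hx
  have hQ : v ⬝ᵥ (screwMatrix (M - 1)).mulVec v =
      ∑ m ∈ Icc 2 M, ∑ m' ∈ Icc 2 M,
        zetaScrewKernel (Real.log m) (Real.log m') * (x m * x m') :=
    dotProduct_mulVec_screwMatrix M x
  have ht : Summable fun ρ : ZetaZeros.riemannZetaNontrivialZeros =>
      (riemannZetaZeroOrder (ρ : ℂ) : ℝ) / (ρ : ℂ).im ^ 2 *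
        ‖-1 + ∑ m ∈ Icc 2 M, ((a m : ℝ) : ℂ) *
          (m : ℂ) ^ ((((ρ : ℂ).im : ℝ) : ℂ) * Complex.I)‖ ^ 2 :=
    (hW.mul_right ((1 + ∑ m ∈ Icc 2 M, |a m|) ^ 2)).of_nonneg_of_le
      (fun ρ => mul_nonneg (hWnn ρ) (sq_nonneg _)) fun ρ =>
      mul_le_mul_of_nonneg_left
        (pow_le_pow_left₀ (norm_nonneg _) (norm_neg_one_add_sum_cpow_le M a _) 2) (hWnn ρ)
  have hu : Summable fun ρ : ZetaZeros.riemannZetaNontrivialZeros =>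
      (riemannZetaZeroOrder (ρ : ℂ) : ℝ) / (ρ : ℂ).im ^ 2 *
        ‖∑ m ∈ Icc 2 M, ((e M m : ℝ) : ℂ) *
          (m : ℂ) ^ ((((ρ : ℂ).im : ℝ) : ℂ) * Complex.I)‖ ^ 2 :=
    (hW.mul_right ((∑ m ∈ Icc 2 M, |e M m|) ^ 2)).of_nonneg_of_le
      (fun ρ => mul_nonneg (hWnn ρ) (sq_nonneg _)) fun ρ =>
      mul_le_mul_of_nonneg_left
        (pow_le_pow_left₀ (norm_nonneg _) (norm_sum_cpow_le M (e M) _) 2) (hWnn ρ)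
  have hsplit : v ⬝ᵥ (screwMatrix (M - 1)).mulVec v ≤ (1 + δ) * A + (1 + 1 / δ) * B := by
    rw [hQ, hA, hB]
    refine hasSum_le_of_le_add hG ht hu fun ρ => ?_
    have h3 := norm_add_sq_le_of_pos
      (-1 + ∑ m ∈ Icc 2 M, ((a m : ℝ) : ℂ) * (m : ℂ) ^ ((((ρ : ℂ).im : ℝ) : ℂ) * Complex.I))
      (∑ m ∈ Icc 2 M, ((e M m : ℝ) : ℂ) * (m : ℂ) ^ ((((ρ : ℂ).im : ℝ) : ℂ) * Complex.I)) hδ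
    rw [neg_one_add_sum_split M x a (e M) hxm]
    have h4 := mul_le_mul_of_nonneg_left h3 (hWnn ρ)
    linarith only [h4]
  -- numerator: M · vᵀ S v ≤ L/4 + e₀′ + ε/2
  have hB0 : 0 ≤ B := by rw [hB]; exact tsum_nonneg fun ρ => mul_nonneg (hWnn ρ) (sq_nonneg _)
  have hMB : (M : ℝ) * B ≤ ε / 16 := by
    have h1 : (M : ℝ) * B ≤ (M : ℝ) * L * B := by
      have := mul_le_mul_of_nonneg_left hF5 (mul_nonneg hMpos.le hB0)
      linarith only [this]
    linarith only [h1, hF4B]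
  have hnum : (M : ℝ) * (v ⬝ᵥ (screwMatrix (M - 1)).mulVec v) ≤
      L / 4 + (screwFloorFirstOrderConst - (1 - Real.eulerMascheroniConstant) / 4) + ε / 2 := by
    have h1 := mul_le_mul_of_nonneg_left hsplit hMpos.le
    have e1 : (1 + δ) * ((M : ℝ) * A) ≤ (1 + δ) *
        (L / 4 + (screwFloorFirstOrderConst - (1 - Real.eulerMascheroniConstant) / 4) + ε / 8) :=
      mul_le_mul_of_nonneg_left hF1' (by positivity)
    have e1' : δ * (L / 4 + (screwFloorFirstOrderConst - (1 - Real.eulerMascheroniConstant) / 4)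
        + ε / 8) ≤ ε / 32 + ε / 32 := by
      have hδL : δ * (L / 4) = ε / 32 := by
        rw [hδdef, div_eq_mul_inv, mul_inv]
        field_simp
        ring
      have h2 : δ * ((screwFloorFirstOrderConst - (1 - Real.eulerMascheroniConstant) / 4) + ε / 8)
          ≤ ε / 32 := by
        have h3 : δ * ((screwFloorFirstOrderConst - (1 - Real.eulerMascheroniConstant) / 4) + ε / 8)
            ≤ δ * (|screwFloorFirstOrderConst - (1 - Real.eulerMascheroniConstant) / 4| + ε / 8) :=
          mul_le_mul_of_nonneg_left (by
            linarith only [le_abs_self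
              (screwFloorFirstOrderConst - (1 - Real.eulerMascheroniConstant) / 4)]) hδ.le
        have h4 : δ * (|screwFloorFirstOrderConst - (1 - Real.eulerMascheroniConstant) / 4| + ε / 8)
            = ε / 8 * ((|screwFloorFirstOrderConst - (1 - Real.eulerMascheroniConstant) / 4| + ε / 8)
              * L⁻¹) := by
          rw [hδdef, div_eq_mul_inv, mul_inv]; ring
        have h5 : ε / 8 * ((|screwFloorFirstOrderConst - (1 - Real.eulerMascheroniConstant) / 4|
            + ε / 8) * L⁻¹) ≤ ε / 8 * (1 / 4) :=
          mul_le_mul_of_nonneg_left hF8 (by positivity)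
        linarith only [h3, h4, h5]
      linarith only [hδL, h2]
    have e2 : (1 + 1 / δ) * ((M : ℝ) * B) ≤ ε / 16 + ε / 16 := by
      have h2 : 1 / δ * ((M : ℝ) * B) = 8 / ε * ((M : ℝ) * L * B) := by
        rw [hδdef, one_div, inv_div, div_eq_mul_inv, div_eq_mul_inv]; ring
      have h3 : 8 / ε * ((M : ℝ) * L * B) ≤ 8 / ε * (ε ^ 2 / 128) :=
        mul_le_mul_of_nonneg_left hF4A.le (by positivity)
      have h4 : 8 / ε * (ε ^ 2 / 128) = ε / 16 := by field_simp; ring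
      have h5 : (1 + 1 / δ) * ((M : ℝ) * B) = (M : ℝ) * B + 1 / δ * ((M : ℝ) * B) := by ring
      rw [h5, h2]
      linarith only [hMB, h3, h4]
    have h1' : (M : ℝ) * (v ⬝ᵥ (screwMatrix (M - 1)).mulVec v) ≤
        (1 + δ) * ((M : ℝ) * A) + (1 + 1 / δ) * ((M : ℝ) * B) := by linarith only [h1]
    have e1'' : (1 + δ) *
        (L / 4 + (screwFloorFirstOrderConst - (1 - Real.eulerMascheroniConstant) / 4) + ε / 8) =
        (L / 4 + (screwFloorFirstOrderConst - (1 - Real.eulerMascheroniConstant) / 4) + ε / 8) +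
          δ * (L / 4 + (screwFloorFirstOrderConst - (1 - Real.eulerMascheroniConstant) / 4)
            + ε / 8) := by ring
    linarith only [h1', e1, e1', e2, e1'', hε]
  -- denominator: vᵀ v ≥ L + γ − 1 − ε/2
  have hE : L * ∑ m ∈ Icc 2 M, e M m ^ 2 ≤ ε ^ 2 / 64 := hF3.le
  have hsumsq : ∑ m ∈ Icc 2 M, a m ^ 2 = ((harmonic M : ℚ) : ℝ) - 1 - 3 / 4 * (M : ℝ)⁻¹ := by
    simp only [ha]; exact sum_halfEta_sq M hM2
  have ha_lower : L + Real.eulerMascheroniConstant - 1 - ε / 8 ≤ ∑ m ∈ Icc 2 M, a m ^ 2 := by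
    rw [hsumsq]
    have := (abs_lt.mp hF6).1
    linarith only [this, hF7]
  have ha_upper : ∑ m ∈ Icc 2 M, a m ^ 2 ≤ L + Real.eulerMascheroniConstant - 1 + ε / 8 := by
    rw [hsumsq]
    have := (abs_lt.mp hF6).2
    have h0 : 0 ≤ 3 / 4 * (M : ℝ)⁻¹ := by positivity
    linarith only [this, h0, hε]
  have hden : L + Real.eulerMascheroniConstant - 1 - ε / 2 ≤ v ⬝ᵥ v := by
    have hvv : v ⬝ᵥ v = ∑ m ∈ Icc 2 M, x m ^ 2 := dotProduct_self_trial M x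
    have hterm : ∑ m ∈ Icc 2 M, ((1 - δ) * a m ^ 2 - (1 / δ) * e M m ^ 2) ≤
        ∑ m ∈ Icc 2 M, x m ^ 2 :=
      Finset.sum_le_sum fun m _ => by rw [hxm]; exact sq_add_ge (a m) (e M m) hδ
    have hsum : ∑ m ∈ Icc 2 M, ((1 - δ) * a m ^ 2 - (1 / δ) * e M m ^ 2) =
        (1 - δ) * ∑ m ∈ Icc 2 M, a m ^ 2 - (1 / δ) * ∑ m ∈ Icc 2 M, e M m ^ 2 := by
      rw [Finset.sum_sub_distrib, Finset.mul_sum, Finset.mul_sum]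
    rw [hvv]
    have hE' : (1 / δ) * ∑ m ∈ Icc 2 M, e M m ^ 2 ≤ ε / 8 := by
      have h2 : (1 / δ) * ∑ m ∈ Icc 2 M, e M m ^ 2 = 8 / ε * (L * ∑ m ∈ Icc 2 M, e M m ^ 2) := by
        rw [hδdef, one_div, inv_div, div_eq_mul_inv, div_eq_mul_inv]; ring
      have h3 : 8 / ε * (L * ∑ m ∈ Icc 2 M, e M m ^ 2) ≤ 8 / ε * (ε ^ 2 / 64) :=
        mul_le_mul_of_nonneg_left hE (by positivity)
      have h4 : 8 / ε * (ε ^ 2 / 64) = ε / 8 := by field_simp; ring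
      linarith only [h2, h3, h4]
    have hloss : δ * ∑ m ∈ Icc 2 M, a m ^ 2 ≤ ε / 8 + ε / 8 := by
      have h2 : δ * ∑ m ∈ Icc 2 M, a m ^ 2 ≤ δ * (L + Real.eulerMascheroniConstant - 1 + ε / 8) :=
        mul_le_mul_of_nonneg_left ha_upper hδ.le
      have h3 : δ * L = ε / 8 := by
        rw [hδdef, div_eq_mul_inv, mul_inv]
        field_simp
      have h4 : δ * (Real.eulerMascheroniConstant - 1 + ε / 8) ≤ ε / 8 := by
        have h5 : δ * (Real.eulerMascheroniConstant - 1 + ε / 8) ≤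
            δ * (|Real.eulerMascheroniConstant - 1| + ε / 8) :=
          mul_le_mul_of_nonneg_left
            (by linarith only [le_abs_self (Real.eulerMascheroniConstant - 1)]) hδ.le
        have h6 : δ * (|Real.eulerMascheroniConstant - 1| + ε / 8) =
            ε / 8 * ((|Real.eulerMascheroniConstant - 1| + ε / 8) * L⁻¹) := by
          rw [hδdef, div_eq_mul_inv, mul_inv]; ring
        have h7 : ε / 8 * ((|Real.eulerMascheroniConstant - 1| + ε / 8) * L⁻¹) ≤ ε / 8 * 1 :=
          mul_le_mul_of_nonneg_left hF9 (by positivity)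
        linarith only [h5, h6, h7]
      have h5 : δ * (L + Real.eulerMascheroniConstant - 1 + ε / 8) =
          δ * L + δ * (Real.eulerMascheroniConstant - 1 + ε / 8) := by ring
      linarith only [h2, h3, h4, h5]
    rw [hsum] at hterm
    generalize ∑ m ∈ Icc 2 M, a m ^ 2 = S1 at hterm hloss ha_lower
    generalize ∑ m ∈ Icc 2 M, e M m ^ 2 = S2 at hterm hE'
    generalize ∑ m ∈ Icc 2 M, x m ^ 2 = S3 at hterm ⊢
    have h1δ : (1 - δ) * S1 = S1 - δ * S1 := by ring
    linarith only [hterm, hE', hloss, ha_lower, h1δ]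
  -- conclusion: the denominator floor `D = L + γ − 1 − ε/2` and the bound `b = 1/4 + (a′+ε)/L`
  -- are positive, and `L/4 + e₀′ + ε/2 ≤ b · D`
  have hD : 0 < L + Real.eulerMascheroniConstant - 1 - ε / 2 := by
    have := Real.one_half_lt_eulerMascheroniConstant
    linarith only [this, hF11, hε]
  have hb : 0 < 1 / 4 + (screwFloorFirstOrderConst + ε) / L := by
    have h1 : -(1 / 8 : ℝ) ≤ (screwFloorFirstOrderConst + ε) / L := by
      have h2 : |(screwFloorFirstOrderConst + ε) / L| ≤ 1 / 8 := by
        rw [abs_div, abs_of_pos hLpos, div_eq_mul_inv]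
        exact hF12
      linarith only [h2, neg_abs_le ((screwFloorFirstOrderConst + ε) / L)]
    linarith only [h1]
  have hkey : L / 4 + (screwFloorFirstOrderConst - (1 - Real.eulerMascheroniConstant) / 4) + ε / 2 ≤
      (1 / 4 + (screwFloorFirstOrderConst + ε) / L) * (L + Real.eulerMascheroniConstant - 1 - ε / 2) := by
    have hexp : (1 / 4 + (screwFloorFirstOrderConst + ε) / L) *
        (L + Real.eulerMascheroniConstant - 1 - ε / 2) =
        L / 4 + (Real.eulerMascheroniConstant - 1) / 4 - ε / 8 + (screwFloorFirstOrderConst + ε) +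
          (screwFloorFirstOrderConst + ε) * (Real.eulerMascheroniConstant - 1 - ε / 2) * L⁻¹ := by
      field_simp
      ring
    have hsmall : -(3 * ε / 8) ≤
        (screwFloorFirstOrderConst + ε) * (Real.eulerMascheroniConstant - 1 - ε / 2) * L⁻¹ := by
      have h1 : |(screwFloorFirstOrderConst + ε) * (Real.eulerMascheroniConstant - 1 - ε / 2) * L⁻¹|
          ≤ 3 * ε / 8 := by
        rw [abs_mul, abs_mul, abs_of_pos (inv_pos.2 hLpos)]
        calc |screwFloorFirstOrderConst + ε| * |Real.eulerMascheroniConstant - 1 - ε / 2| * L⁻¹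
            ≤ |screwFloorFirstOrderConst + ε| * (|Real.eulerMascheroniConstant - 1| + ε / 2) * L⁻¹ := by
              gcongr
              calc |Real.eulerMascheroniConstant - 1 - ε / 2|
                  ≤ |Real.eulerMascheroniConstant - 1| + |ε / 2| := abs_sub _ _
                _ = |Real.eulerMascheroniConstant - 1| + ε / 2 := by
                  rw [abs_of_pos (by positivity : (0 : ℝ) < ε / 2)]
          _ ≤ 3 * ε / 8 := hF10
      linarith only [h1, neg_abs_le
        ((screwFloorFirstOrderConst + ε) * (Real.eulerMascheroniConstant - 1 - ε / 2) * L⁻¹)]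
    rw [hexp]
    linarith only [hsmall]
  have hvv_pos : 0 < v ⬝ᵥ v := lt_of_lt_of_le hD hden
  refine ⟨v, fun hv0 => ?_, ?_⟩
  · rw [hv0, dotProduct_zero] at hvv_pos
    exact lt_irrefl _ hvv_pos
  · have hfinal : (M : ℝ) * (v ⬝ᵥ (screwMatrix (M - 1)).mulVec v) ≤
        (1 / 4 + (screwFloorFirstOrderConst + ε) / L) * (v ⬝ᵥ v) := by
      have p2 := mul_le_mul_of_nonneg_left hden hb.le
      linarith only [hnum, hkey, p2]
    have hR : screwRayleigh M v = (v ⬝ᵥ (screwMatrix (M - 1)).mulVec v) / (v ⬝ᵥ v) := rfl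
    rw [hR, ← mul_div_assoc, div_le_iff₀ hvv_pos]
    exact hfinal

end Summit.RiemannHypothesis.RiemannHypothesis.Theorems.EtaTailTrialBound.Trial

end
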